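import Summits.QuantumFields.YangMills.Theorems.FlatTubeReductionValleyRelocalisationNearRegionCore
import HarnessLib

/-!
# Valley relocalisation of near-top tube maximisers INTO RED'S NEAR REGION, eventually in `β`
# (route `FlatTubeReduction`, bears on K1 `NearFlatRatioLaw` 24720 / K1a 24921 / K1b 25191; rung R2b1 = RECORD-label femto gap — no summit statement is proved here)

Seat `ym-line-ftr-p1` g3 (prover).  From the one-coupling core `ValleyReloc.relocalise_core_nearRegion` and RED's valley gain:
* ★★ `valleyRelocalisation_nearRegion_at` — for every `L`, `θ ∈ (0,1)`, `B ≥ 0`, scales `p ≤ 1/6`, `q < 1`: `ValleyGainAt L (powScale p) (powScale q)` and the K2 shape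
  (`OffTubeSuppression` at this `L`, PROVED: `FlatTubeReduction.offTubeSuppression_proof L`; kept a hypothesis so that this module stays outside the route file's
  import cone) give: eventually in `β`, every `θ`-tube maximiser `ψ ⊥ Ω` with `(1 − Bλ_b)λ₀‖ψ‖² ≤ ⟨ψ,K_βψ⟩` admits a physical `ψ' ⊥ Ω`, `θ`-tube supported,
  supported in the NEAR REGION `{U | ∃ z, orbitDist (TT.twist3 z U) < β^{−p}}`, with `‖ψ'‖ ≤ ‖ψ‖` and `⟨ψ,Kψ⟩ ≤ ⟨ψ',Kψ'⟩ + C(λ_b²/L)λ₀‖ψ‖²`;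
* ★★ `valleyRelocalisation_nearRegion_at_ledger` (`L ≥ 2`, `p = 1/40`, RED's PROVED `valleyGainAt_ledger` — the inner region of the FixedLatticeLaw lead's
  `stub_boRate` VERBATIM), `…_at_pow` (RED's proved window), ★★ `…_at_window` (`L ≥ 2`, EVERY `p ∈ (0, 1/17)`, admissible exponents chosen explicitly).
Companion glue: `FlatTubeReductionNearFlatNearRegionGlue` (K1 ⇐ a BO ratio law for near-region tube states, everything else discharged).
HONEST FRAMING: fixed spatial lattice, bare coupling `β → ∞`; nothing here concerns infinite volume, the continuum limit, or the Clay Yang–Mills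
mass gap.  No definitions, no named facts, no `sorry`.
References: B. Simon, Ann. Phys. 146 (1983) 209 [cite: SimonB1983DiscreteSpectrum, §3]; M. Lüscher, NPB 219 (1983) 233 [cite: Luscher1983, §2–3];
Lüscher–Münster, NPB 232 (1984) 445 [cite: LuscherMunster1984, §2]; Reed–Simon IV [cite: ReedSimonIV1978, Thm. XIII.1].
-/

set_option autoImplicit false

noncomputable section

open MeasureTheory Filter Topology Real
open Literature.MathematicalPhysics.QuantumFieldTheory
open Literature.MathematicalPhysics.QuantumLattice

namespace Summit.QuantumFields.YangMills.Theorems.FemtoTransferGap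

namespace ValleyReloc

open Summit.QuantumFields.YangMills.Theorems.FemtoTransferGap.OffTube

variable {L : ℕ} [NeZero L]

/-! ## §2 Eventually in `β`: near-region relocalisation of near-top tube maximisers from the gain alone -/

/-- ★★ **Near-region relocalisation of near-top tube maximisers from RED's valley gain at scale `(β^{−p}, β^{−q})`** (`p ≤ 1/6`, `q < 1`), for every
`B ≥ 0`: output supported in `{∃ z, orbitDist (TT.twist3 z U) < β^{−p}}`; NO first-level lower bound.  K2 (`OffTubeSuppression` at this `L`, PROVED in the
tree) is a spelled-out hypothesis. [cite: SimonB1983DiscreteSpectrum, §3] [cite: Luscher1983, §2–3] [cite: LuscherMunster1984, §2] [cite: ReedSimonIV1978, Thm. XIII.1] -/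
theorem valleyRelocalisation_nearRegion_at {θ p q B : ℝ} (hθ0 : 0 < θ) (hθ1 : θ < 1) (hp : p ≤ 1 / 6)
    (hq1 : q < 1) (hB : 0 ≤ B)
    (hK2 : ∀ θ' : ℝ, 0 < θ' → θ' < 1 → ∃ β0 : ℝ, ∀ β : ℝ, β0 ≤ β → ∀ (Ω ψ : GaugeConfig 3 L SU2 → ℝ), IsPhys Ω →
      (∀ U, 0 < Ω U) → transferApply β Ω = topValue su2Rep L β • Ω → IsPhys ψ → l2 ψ Ω = 0 →
      ∃ ψ' : GaugeConfig 3 L SU2 → ℝ, IsPhys ψ' ∧ l2 ψ' Ω = 0 ∧ (∀ U, β ^ (-θ') < wilsonAction su2Rep U → ψ' U = 0) ∧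
        l2 ψ' ψ' ≤ l2 ψ ψ ∧ qform su2Rep β ψ ψ ≤ qform su2Rep β ψ' ψ' + bareLambda β ^ 3 / L * topValue su2Rep L β * l2 ψ ψ)
    (hGain : ValleyGainAt L (powScale p) (powScale q)) :
    ∃ C β0 : ℝ, 0 ≤ C ∧ ∀ β : ℝ, β0 ≤ β → ∀ (Ω ψ : GaugeConfig 3 L SU2 → ℝ), IsPhys Ω → (∀ U, 0 < Ω U) →
      transferApply β Ω = topValue su2Rep L β • Ω → IsPhys ψ → l2 ψ Ω = 0 →
      (∀ U, β ^ (-θ) < wilsonAction su2Rep U → ψ U = 0) →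
      (1 - B * bareLambda β) * topValue su2Rep L β * l2 ψ ψ ≤ qform su2Rep β ψ ψ →
      (∀ φ : GaugeConfig 3 L SU2 → ℝ, IsPhys φ → l2 φ Ω = 0 → (∀ U, β ^ (-θ) < wilsonAction su2Rep U → φ U = 0) →
        qform su2Rep β φ φ * l2 ψ ψ ≤ qform su2Rep β ψ ψ * l2 φ φ) →
      ∃ ψ' : GaugeConfig 3 L SU2 → ℝ, IsPhys ψ' ∧ l2 ψ' Ω = 0 ∧ (∀ U, β ^ (-θ) < wilsonAction su2Rep U → ψ' U = 0) ∧
        (∀ U, ψ' U ≠ 0 → ∃ z : Fin 3 → Bool, orbitDist (TT.twist3 z U) < powScale p β) ∧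
        l2 ψ' ψ' ≤ l2 ψ ψ ∧
        qform su2Rep β ψ ψ ≤ qform su2Rep β ψ' ψ' + C * bareLambda β ^ 2 / L * topValue su2Rep L β * l2 ψ ψ := by
  have hLpos : (0 : ℝ) < (L : ℝ) := by exact_mod_cast Nat.pos_of_ne_zero (NeZero.ne L)
  have hLne : (L : ℝ) ≠ 0 := hLpos.ne'
  -- constants
  set C₁ : ℝ := 96 * π ^ 2 * (Fintype.card (Edge 3 L) : ℝ) ^ 2 / uniformFloorConst L with hC₁
  have huf := uniformFloorConst_pos (L := L)
  have hC₁0 : 0 ≤ C₁ := by positivity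
  set Cω : ℝ := 1 + 2 * C₁ with hCω
  have hCω0 : 0 ≤ Cω := by positivity
  set K : ℝ := 16 + 8 * B * Cω + 32 * Cω ^ 2 + 8 * C₁ with hK
  have hK0 : 0 ≤ K := by positivity
  set θs : ℝ := max θ q with hθs
  have hθs0 : 0 < θs := lt_max_of_lt_left hθ0
  have hθs1 : θs < 1 := max_lt hθ1 hq1
  -- thresholds
  obtain ⟨β₂, H2⟩ := hK2 θ hθ0 hθ1
  obtain ⟨β₃, H3⟩ := hK2 θs hθs0 hθs1
  set A : ℝ := 2 * L * (B + 1) with hA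
  obtain ⟨β₄, H4⟩ := hGain A
  obtain ⟨β₆, H6⟩ := eventually_sq_mul_exp_le hθs1 (c := 2 * uniformFloorConst L / 7) (by positivity)
  set t₀ : ℝ := min (1 / (2 * (B + 1))) (min (1 / (8 * Cω)) (1 / (4 * (2 + B * Cω + C₁)))) with ht₀
  have ht₀pos : 0 < t₀ := by rw [ht₀]; positivity
  set β0 : ℝ := max (max 2 (max β₂ β₃)) (max β₄ (max β₆ (2 / t₀ ^ 3))) with hβ0def
  refine ⟨L * K, β0, by positivity, fun β hβ Ω ψ hΩ hΩpos heig hψ hψΩ _ hnear hmax => ?_⟩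
  -- unpack `β ≥ β0`
  have hge : ∀ x : ℝ, x ≤ β0 → x ≤ β := fun x hx => hx.trans hβ
  have hβ2 : (2 : ℝ) ≤ β := hge _ (by rw [hβ0def]; exact le_max_of_le_left (le_max_left _ _))
  have hβ1 : (1 : ℝ) ≤ β := by linarith only [hβ2]
  have hβpos : 0 < β := by linarith only [hβ2]
  have hββ₂ : β₂ ≤ β := hge _ (by rw [hβ0def]; exact le_max_of_le_left (le_max_of_le_right (le_max_left _ _)))
  have hββ₃ : β₃ ≤ β := hge _ (by rw [hβ0def]; exact le_max_of_le_left (le_max_of_le_right (le_max_right _ _)))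
  have hββ₄ : β₄ ≤ β := hge _ (by rw [hβ0def]; exact le_max_of_le_right (le_max_left _ _))
  have hββ₆ : β₆ ≤ β := hge _ (by rw [hβ0def]; exact le_max_of_le_right (le_max_of_le_right (le_max_left _ _)))
  have hβt : 2 / t₀ ^ 3 ≤ β := hge _ (by rw [hβ0def]; exact le_max_of_le_right (le_max_of_le_right (le_max_right _ _)))
  have hv0 : 0 < bareLambda β := by unfold bareLambda; exact Real.rpow_pos_of_pos (by positivity) _
  have hv1 : bareLambda β ≤ 1 := by
    unfold bareLambda
    apply Real.rpow_le_one (by positivity) _ (by norm_num)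
    rw [div_le_one hβpos]; exact hβ2
  set v : ℝ := bareLambda β with hv
  have hvt : v ≤ t₀ := bareLambda_le_of_le ht₀pos hβt
  have hvB : v ≤ 1 / (2 * (B + 1)) := hvt.trans (min_le_left _ _)
  have hvω : v ≤ 1 / (8 * Cω) := hvt.trans ((min_le_right _ _).trans (min_le_left _ _))
  have hvs : v ≤ 1 / (4 * (2 + B * Cω + C₁)) := hvt.trans ((min_le_right _ _).trans (min_le_right _ _))
  set lam : ℝ := topValue su2Rep L β with hlam
  have hlam0 : 0 < lam := topValue_su2Rep_pos L β
  -- the scales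
  set δ : ℝ := powScale p β with hδdef
  have hδpos : 0 < δ := powScale_pos p β
  have hδq : β ^ (-θs) ≤ powScale q β := by
    rw [powScale_eq hβ1]; exact Real.rpow_le_rpow_of_exponent_le hβ1 (neg_le_neg (le_max_right θ q))
  have htube : β ^ (-θs) ≤ β ^ (-θ) := Real.rpow_le_rpow_of_exponent_le hβ1 (neg_le_neg (le_max_left θ q))
  -- the gain at this `β`
  set γ : ℝ := 1 - Real.exp (-(A * bareLambda ((L : ℝ) ^ 3 * β))) with hγdef
  have hAv : A * bareLambda ((L : ℝ) ^ 3 * β) = 2 * ((B + 1) * v) := by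
    rw [bareLambda_cube_mul hβpos L, hA, hv,
      show 2 * (L : ℝ) * (B + 1) * (bareLambda β / L) = 2 * (B + 1) * ((L : ℝ) * (bareLambda β / L)) by ring,
      mul_div_cancel₀ _ hLne]
    ring
  have hγ1 : γ ≤ 1 := by rw [hγdef]; linarith only [Real.exp_pos (-(A * bareLambda ((L : ℝ) ^ 3 * β)))]
  have hx1 : (B + 1) * v ≤ 1 / 2 := by
    have h := (le_div_iff₀ (by positivity : (0 : ℝ) < 2 * (B + 1))).1 hvB
    linarith only [h]
  have hγB : (B + 1) * v ≤ γ := by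
    rw [hγdef, hAv]
    -- `x ≤ 1 − e^{−2x}` for `0 ≤ x ≤ 1/2`: `e^{2x} ≥ 1 + 2x` and `1/(1+2x) ≤ 1 − x`
    have hx0 : 0 ≤ (B + 1) * v := by positivity
    have hpos : 0 < 1 + 2 * ((B + 1) * v) := by linarith only [hx0]
    have h2 : Real.exp (-(2 * ((B + 1) * v))) ≤ (1 + 2 * ((B + 1) * v))⁻¹ := by
      rw [Real.exp_neg]
      exact inv_anti₀ hpos (by linarith only [Real.add_one_le_exp (2 * ((B + 1) * v))])
    have h3 : (1 + 2 * ((B + 1) * v))⁻¹ ≤ 1 - (B + 1) * v := by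
      have hprod := mul_nonneg hx0 (sub_nonneg.2 hx1)
      rw [inv_eq_one_div, div_le_iff₀ hpos]; linarith only [hprod]
    linarith only [h2, h3]
  have hγv : v ≤ γ := le_trans (le_mul_of_one_le_left hv0.le (by linarith only [hB])) hγB
  have hγpos : 0 < γ := lt_of_lt_of_le hv0 hγv
  have hgain : ∀ f : GaugeConfig 3 L SU2 → ℝ, IsPhys f →
      (∀ U, f U ≠ 0 → wilsonAction su2Rep U ≤ β ^ (-θs) ∧ Real.sin (innerPhase δ U) ≠ 0) →
      qform su2Rep β f f ≤ (1 - γ) * lam * l2 f f := by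
    intro f hf hsupp
    have h := H4 β hββ₄ f hf fun U hU => by
      obtain ⟨hS, hsin⟩ := hsupp U hU
      exact ⟨lt_of_le_of_lt (hS.trans hδq) (by linarith only [powScale_pos q β]), forall_lt_orbitDist_of_sin_ne_zero hδpos hsin⟩
    rw [levelValue_zero] at h
    have e : Real.exp (-(A * bareLambda ((L : ℝ) ^ 3 * β))) = 1 - γ := by rw [hγdef]; ring
    rw [e] at h
    exact h
  -- the IMS defect and the ground-state mass defect
  have hε : (1 / 2) * ((Fintype.card (Edge 3 L) : ℝ) ^ 2 * (8 * π / δ) ^ 2 * (3 / β) * latCE L β) ≤ C₁ * v ^ 2 * lam :=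
    imsDefect_powScale_le hβ1 hp
  have hfl := levelValue_zero_ge_uniform (L := L) hβ1
  rw [levelValue_zero] at hfl
  have hlat0 : 0 < latCE L β := latCE_pos hβpos.le
  set E : ℝ := Real.exp (-(β * β ^ (-θs))) with hE
  have hE0 : 0 < E := Real.exp_pos _
  have hv3 : v ^ 3 = 2 / β := by
    rw [hv, bareLambda, ← Real.rpow_natCast, ← Real.rpow_mul (by positivity)]; norm_num
  have hE7 : 7 * E ≤ v ^ 3 * uniformFloorConst L := seven_mul_le_of_sq_mul_le hβ1 hE0.le (H6 β hββ₆) hv3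
  have hω : E * latCE L β / lam + 2 / (γ * lam) * ((1 + 2 / γ) * (E * latCE L β) +
      (1 / 2) * ((Fintype.card (Edge 3 L) : ℝ) ^ 2 * (8 * π / δ) ^ 2 * (3 / β) * latCE L β)) ≤ Cω * v := by
    rw [hCω]
    exact omega_scalar_bound hlam0 hv0 hγv hγ1 hfl hlat0.le hE0.le hE7 hε hC₁0
  have hCωpos : 0 < Cω := by rw [hCω]; positivity
  have hω8 : Cω * v ≤ 1 / 8 := by
    have h := (le_div_iff₀ (by positivity : (0 : ℝ) < 8 * Cω)).1 hvω
    linarith only [h]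
  have hsmallv : v * (4 * (2 + B * Cω + C₁)) ≤ 1 :=
    (le_div_iff₀ (by positivity : (0 : ℝ) < 4 * (2 + B * Cω + C₁))).1 hvs
  -- ★ the one-coupling core (near-region form)
  obtain ⟨ψ', hψ', hψ'Ω, hsupp', hnear', hle', hq'⟩ :=
    relocalise_core_nearRegion hβ2 hδpos htube hΩ hΩpos heig (H2 β hββ₂ Ω · hΩ hΩpos heig) (H3 β hββ₃ Ω · hΩ hΩpos heig)
      hgain hγ1 hB hγB hCω0 hω8 hω hC₁0 hε hsmallv hψ hψΩ hnear hmax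
  refine ⟨ψ', hψ', hψ'Ω, hsupp', hnear', hle', hq'.trans (le_of_eq ?_)⟩
  rw [mul_assoc (L : ℝ) K (v ^ 2), mul_div_cancel_left₀ _ hLne]

/-! ## §3 At the ledger scales (`L ≥ 2`): unconditional but for the proved K2 shape -/

/-- ★★ **Near-region relocalisation at `L ≥ 2` into `{∃ z, orbitDist (TT.twist3 z U) < β^{−1/40}}`** (the FixedLatticeLaw lead's inner region VERBATIM), every
`θ ∈ (0,1)`, every `B ≥ 0` — from RED's PROVED `valleyGainAt_ledger` (`p = 1/40`, `q = 17/20`); the ONLY hypothesis left is the K2 shape (PROVED: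
`FlatTubeReduction.offTubeSuppression_proof L`). [cite: Luscher1983, §2–3] [cite: LuscherMunster1984, §2] [cite: SimonB1983DiscreteSpectrum, §3] -/
theorem valleyRelocalisation_nearRegion_at_ledger (hL : 2 ≤ L) {θ B : ℝ} (hθ0 : 0 < θ) (hθ1 : θ < 1) (hB : 0 ≤ B)
    (hK2 : ∀ θ' : ℝ, 0 < θ' → θ' < 1 → ∃ β0 : ℝ, ∀ β : ℝ, β0 ≤ β → ∀ (Ω ψ : GaugeConfig 3 L SU2 → ℝ), IsPhys Ω →
      (∀ U, 0 < Ω U) → transferApply β Ω = topValue su2Rep L β • Ω → IsPhys ψ → l2 ψ Ω = 0 →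
      ∃ ψ' : GaugeConfig 3 L SU2 → ℝ, IsPhys ψ' ∧ l2 ψ' Ω = 0 ∧ (∀ U, β ^ (-θ') < wilsonAction su2Rep U → ψ' U = 0) ∧
        l2 ψ' ψ' ≤ l2 ψ ψ ∧ qform su2Rep β ψ ψ ≤ qform su2Rep β ψ' ψ' + bareLambda β ^ 3 / L * topValue su2Rep L β * l2 ψ ψ) :
    ∃ C β0 : ℝ, 0 ≤ C ∧ ∀ β : ℝ, β0 ≤ β → ∀ (Ω ψ : GaugeConfig 3 L SU2 → ℝ), IsPhys Ω → (∀ U, 0 < Ω U) →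
      transferApply β Ω = topValue su2Rep L β • Ω → IsPhys ψ → l2 ψ Ω = 0 →
      (∀ U, β ^ (-θ) < wilsonAction su2Rep U → ψ U = 0) →
      (1 - B * bareLambda β) * topValue su2Rep L β * l2 ψ ψ ≤ qform su2Rep β ψ ψ →
      (∀ φ : GaugeConfig 3 L SU2 → ℝ, IsPhys φ → l2 φ Ω = 0 → (∀ U, β ^ (-θ) < wilsonAction su2Rep U → φ U = 0) →
        qform su2Rep β φ φ * l2 ψ ψ ≤ qform su2Rep β ψ ψ * l2 φ φ) →
      ∃ ψ' : GaugeConfig 3 L SU2 → ℝ, IsPhys ψ' ∧ l2 ψ' Ω = 0 ∧ (∀ U, β ^ (-θ) < wilsonAction su2Rep U → ψ' U = 0) ∧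
        (∀ U, ψ' U ≠ 0 → ∃ z : Fin 3 → Bool, orbitDist (TT.twist3 z U) < powScale (1 / 40) β) ∧
        l2 ψ' ψ' ≤ l2 ψ ψ ∧
        qform su2Rep β ψ ψ ≤ qform su2Rep β ψ' ψ' + C * bareLambda β ^ 2 / L * topValue su2Rep L β * l2 ψ ψ :=
  valleyRelocalisation_nearRegion_at (p := 1 / 40) (q := 17 / 20) hθ0 hθ1 (by norm_num) (by norm_num) hB hK2
    (Summit.QuantumFields.YangMills.Theorems.FemtoCutoffLadder.valleyGainAt_ledger hL)

/-- ★★ **Near-region relocalisation at `L ≥ 2` into `{∃ z, orbitDist (TT.twist3 z U) < β^{−p}}` over RED's whole proved window of scales**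
(`valleyGainAt_pow_of_two_le`: `0 < p < 1/10`, `4p < q < 1`, auxiliary exponents `(r, m)`), every `θ`, every `B ≥ 0`; the only hypothesis left is the (proved)
K2 shape. [cite: Luscher1983, §2–3] [cite: LuscherMunster1984, §2] -/
theorem valleyRelocalisation_nearRegion_at_pow (hL : 2 ≤ L) {θ p q r m B : ℝ} (hθ0 : 0 < θ) (hθ1 : θ < 1) (hp0 : 0 < p) (hp : p < 1 / 10)
    (hpq : 4 * p < q) (hq1 : q < 1) (hr : 0 < r) (hr1 : 2 * r < 1) (hm : 0 < m) (hrq : 2 * r < q - m / 2) (hpm : p < m / 2)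
    (hC : 1 + 3 * m - 3 * r < -p) (hB : 0 ≤ B)
    (hK2 : ∀ θ' : ℝ, 0 < θ' → θ' < 1 → ∃ β0 : ℝ, ∀ β : ℝ, β0 ≤ β → ∀ (Ω ψ : GaugeConfig 3 L SU2 → ℝ), IsPhys Ω →
      (∀ U, 0 < Ω U) → transferApply β Ω = topValue su2Rep L β • Ω → IsPhys ψ → l2 ψ Ω = 0 →
      ∃ ψ' : GaugeConfig 3 L SU2 → ℝ, IsPhys ψ' ∧ l2 ψ' Ω = 0 ∧ (∀ U, β ^ (-θ') < wilsonAction su2Rep U → ψ' U = 0) ∧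
        l2 ψ' ψ' ≤ l2 ψ ψ ∧ qform su2Rep β ψ ψ ≤ qform su2Rep β ψ' ψ' + bareLambda β ^ 3 / L * topValue su2Rep L β * l2 ψ ψ) :
    ∃ C β0 : ℝ, 0 ≤ C ∧ ∀ β : ℝ, β0 ≤ β → ∀ (Ω ψ : GaugeConfig 3 L SU2 → ℝ), IsPhys Ω → (∀ U, 0 < Ω U) →
      transferApply β Ω = topValue su2Rep L β • Ω → IsPhys ψ → l2 ψ Ω = 0 →
      (∀ U, β ^ (-θ) < wilsonAction su2Rep U → ψ U = 0) →
      (1 - B * bareLambda β) * topValue su2Rep L β * l2 ψ ψ ≤ qform su2Rep β ψ ψ →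
      (∀ φ : GaugeConfig 3 L SU2 → ℝ, IsPhys φ → l2 φ Ω = 0 → (∀ U, β ^ (-θ) < wilsonAction su2Rep U → φ U = 0) →
        qform su2Rep β φ φ * l2 ψ ψ ≤ qform su2Rep β ψ ψ * l2 φ φ) →
      ∃ ψ' : GaugeConfig 3 L SU2 → ℝ, IsPhys ψ' ∧ l2 ψ' Ω = 0 ∧ (∀ U, β ^ (-θ) < wilsonAction su2Rep U → ψ' U = 0) ∧
        (∀ U, ψ' U ≠ 0 → ∃ z : Fin 3 → Bool, orbitDist (TT.twist3 z U) < powScale p β) ∧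
        l2 ψ' ψ' ≤ l2 ψ ψ ∧
        qform su2Rep β ψ ψ ≤ qform su2Rep β ψ' ψ' + C * bareLambda β ^ 2 / L * topValue su2Rep L β * l2 ψ ψ :=
  valleyRelocalisation_nearRegion_at hθ0 hθ1 (by linarith) hq1 hB hK2
    (Summit.QuantumFields.YangMills.Theorems.FemtoCutoffLadder.valleyGainAt_pow_of_two_le hL hp0 hp hpq hr hr1 hm hrq hpm hC)

/-- ★★ **Near-region relocalisation at `L ≥ 2` into `{∃ z, orbitDist (TT.twist3 z U) < β^{−p}}` for EVERY `p ∈ (0, 1/17)`** (RED's window made explicit: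
admissible `m = 2p + s/2`, `r = 8/17 − 19s/12`, `q = 1 − 91s/24`, `s = 1/17 − p`), every `θ ∈ (0,1)`, every `B ≥ 0`; the only hypothesis left is the (proved)
K2 shape. [cite: Luscher1983, §2–3] [cite: LuscherMunster1984, §2] -/
theorem valleyRelocalisation_nearRegion_at_window (hL : 2 ≤ L) {θ p B : ℝ} (hθ0 : 0 < θ) (hθ1 : θ < 1) (hp0 : 0 < p) (hp1 : p < 1 / 17)
    (hB : 0 ≤ B)
    (hK2 : ∀ θ' : ℝ, 0 < θ' → θ' < 1 → ∃ β0 : ℝ, ∀ β : ℝ, β0 ≤ β → ∀ (Ω ψ : GaugeConfig 3 L SU2 → ℝ), IsPhys Ω →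
      (∀ U, 0 < Ω U) → transferApply β Ω = topValue su2Rep L β • Ω → IsPhys ψ → l2 ψ Ω = 0 →
      ∃ ψ' : GaugeConfig 3 L SU2 → ℝ, IsPhys ψ' ∧ l2 ψ' Ω = 0 ∧ (∀ U, β ^ (-θ') < wilsonAction su2Rep U → ψ' U = 0) ∧
        l2 ψ' ψ' ≤ l2 ψ ψ ∧ qform su2Rep β ψ ψ ≤ qform su2Rep β ψ' ψ' + bareLambda β ^ 3 / L * topValue su2Rep L β * l2 ψ ψ) :
    ∃ C β0 : ℝ, 0 ≤ C ∧ ∀ β : ℝ, β0 ≤ β → ∀ (Ω ψ : GaugeConfig 3 L SU2 → ℝ), IsPhys Ω → (∀ U, 0 < Ω U) →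
      transferApply β Ω = topValue su2Rep L β • Ω → IsPhys ψ → l2 ψ Ω = 0 →
      (∀ U, β ^ (-θ) < wilsonAction su2Rep U → ψ U = 0) →
      (1 - B * bareLambda β) * topValue su2Rep L β * l2 ψ ψ ≤ qform su2Rep β ψ ψ →
      (∀ φ : GaugeConfig 3 L SU2 → ℝ, IsPhys φ → l2 φ Ω = 0 → (∀ U, β ^ (-θ) < wilsonAction su2Rep U → φ U = 0) →
        qform su2Rep β φ φ * l2 ψ ψ ≤ qform su2Rep β ψ ψ * l2 φ φ) →
      ∃ ψ' : GaugeConfig 3 L SU2 → ℝ, IsPhys ψ' ∧ l2 ψ' Ω = 0 ∧ (∀ U, β ^ (-θ) < wilsonAction su2Rep U → ψ' U = 0) ∧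
        (∀ U, ψ' U ≠ 0 → ∃ z : Fin 3 → Bool, orbitDist (TT.twist3 z U) < powScale p β) ∧
        l2 ψ' ψ' ≤ l2 ψ ψ ∧
        qform su2Rep β ψ ψ ≤ qform su2Rep β ψ' ψ' + C * bareLambda β ^ 2 / L * topValue su2Rep L β * l2 ψ ψ := by
  -- explicit admissible exponents, all affine in the slack `s = 1/17 − p > 0`
  set s : ℝ := 1 / 17 - p with hs
  have hs0 : 0 < s := by rw [hs]; linarith
  have hs1 : s < 1 / 17 := by rw [hs]; linarith
  set m : ℝ := 2 * p + s / 2 with hm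
  set r : ℝ := 8 / 17 - 19 * s / 12 with hr
  set q : ℝ := 1 - 91 * s / 24 with hq
  have hps : p = 1 / 17 - s := by rw [hs]; ring
  exact valleyRelocalisation_nearRegion_at_pow hL (p := p) (q := q) (r := r) (m := m) hθ0 hθ1 hp0
    (by rw [hps]; linarith) (by rw [hq, hps]; linarith) (by rw [hq]; linarith) (by rw [hr]; linarith) (by rw [hr]; linarith)
    (by rw [hm]; linarith) (by rw [hr, hq, hm, hps]; linarith) (by rw [hm]; linarith) (by rw [hm, hr, hps]; linarith) hB hK2

end ValleyReloc

end Summit.QuantumFields.YangMills.Theorems.FemtoTransferGap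

end
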